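import Summits.FinalStateConjecture.FinalStateConjecture.Theses.HorizonTypeCascade

/-!
# Birth skeleton (BC3) for crux `SmoothNoHair` (stmt-FinalStateConjecture-18558),
# route `HorizonTypeCascade` — "the printed no-hair flow chart of the CONNECTED horizon type:
# non-rotating leaf · Hawking rigidity from the collar · axisymmetric uniqueness"

planner-skel-stmt-FinalStateConjecture-18558-0 (skeleton registrar, route re-audit bin HONEST), 2026-08-17.
Target: the route decl `Summit.FinalStateConjecture.FinalStateConjecture.Theses.HorizonTypeCascade.SmoothNoHair` (crux, rank 5, route file rev 4) BY NAME, concluded by the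
hypothesis-free `SmoothNoHair_of` from three NAMED stubs used as lemmas; the curried reading
`stub₁-sig → stub₂-sig → stub₃-sig → SmoothNoHair` is kernel-checked twice below — as the theorem
`noHairOfCases_proof`, whose statement is LITERALLY the route's layer-2 glue item
`Summit.FinalStateConjecture.FinalStateConjecture.Theses.HorizonTypeCascade.NoHairOfCases` (stmt-FinalStateConjecture-18818, "provable-now"), and as the closing `example` with the
three signatures written out.

## The line = the route's own two-layer plan for this node (CASCADE.md node 2; Chruściel–Costa 2008 §7,
## Chruściel–Costa–Heusler 2012 §3 flow chart), typed over the route's collar dress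

The crux: an `I⁺`-regular, Ricci-flat stationary AF black hole `𝓑` with CONNECTED future event horizon every
component of which carries a non-degenerate Killing COLLAR (a field `K` Killing on an open `U ⊇` the component,
`[T, K] = 0`, `K ≠ 0` and tangent on it, `∇_K K = κ K`, `κ ≠ 0`) has domain of outer communications isometric to a
sub-extremal Kerr exterior (the `hres`-free pointwise unfolding of `IsIsometricToKerrExterior`).  Branch on the
horizon type of the stationary Killing field `T = 𝓑.killing` ON `𝓔⁺` — `by_cases ∃ p ∈ 𝓔⁺, g(T,T)(p) ≠ 0`:

* `stub_nonRotatingConnectedIsKerr` (leaf 2a, the NON-ROTATING type; = route support item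
  `NonRotatingConnectedIsKerr`, stmt-FinalStateConjecture-18559, BY NAME): if `T` is null on all of `𝓔⁺`, the d.o.c.
  is a Schwarzschild ⊂ sub-extremal Kerr exterior (smooth CC08 §7.2 ¶1 horizon-Killing step in collar dress ⇒
  Sudarsky–Wald staticity ⇒ Chruściel–Galloway / Bunting–Masood-ul-Alam static uniqueness ⇒
  `IsIsometricToSchwarzschildExterior.isIsometricToKerrExterior`).  M-sized from the named facts
  `SudarskyWald1993_staticity`, `ChruscielGalloway2010_docStaticUniqueness` (NonRotatingBlackHoleUniqueness.lean).
* `stub_smoothHawkingRigidity` (leaf 2b, the ROTATING type, LOAD-BEARING and the frontier; = route support item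
  `SmoothHawkingRigidity`, stmt-FinalStateConjecture-18788, BY NAME): if `T` is non-null somewhere on `𝓔⁺`, there is
  a complete axisymmetric Killing field `Y` commuting with `T` — Hawking's rigidity theorem WITHOUT analyticity,
  from the collar (Alexakis–Ionescu–Klainerman arXiv:0902.1173 near Kerr; Ionescu–Klainerman arXiv:1108.3575
  Thm 1.3: the collar field need not extend in general — the open problem of CCH12 §3.4.2).
* `stub_axisymmetricUniqueness` (leaf 2c, CCH12 Thm 3.2 in COLLAR DRESS; verbatim the third binder of the route
  item `NoHairOfCases`): an `I⁺`-regular stationary-axisymmetric vacuum black hole with connected horizon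
  carrying a non-degenerate Killing collar has d.o.c. isometric to a sub-extremal Kerr exterior.  A PRINTED theorem
  (Chruściel–Costa–Heusler 2012 Thm 3.2 / Chruściel–Costa 2008 Thm 5.6 + §§6–7, no analyticity); in-tree its
  vendored dress is the named fact `ChruscielCostaHeusler2012_axisymmetricUniqueness`
  (AxisymmetricBlackHoleUniqueness.lean: GLOBAL horizon Killing field `IsNonDegenerateHorizon 𝓑.Mext`, conclusion
  with `hres`); the two dresses differ by (i) collar + axisymmetry ⇒ global non-degenerate horizon Killing field
  (`K ∝ T + Ω Y` on the connected horizon; an M-sized lemma) and (ii) the `hres` bookkeeping, already proved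
  harmless (`Theorems/SmoothNoHair/Negative/…kerrConclusionPointwise_iff_isIsometricToKerrExterior`).  Not
  imported here on purpose (the route keeps the 6 unproved facts of `BlackHoles.lean` out of its cone).

`SmoothNoHair_of` (sorry-free, 6 lines): cases on `∃ p ∈ 𝓔⁺, g(T,T)(p) ≠ 0`; rotating ⇒ stub 2 gives `Y`,
stub 3 concludes; non-rotating (`push Not`) ⇒ stub 1 concludes.  Hardest stub: `stub_smoothHawkingRigidity`.

## Disproof used / negatives honoured

No `Disproof.lean` exists for this crux (`ledger crux ls stmt-FinalStateConjecture-18558`: no workfiles before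
this one).  The landed negative lemma `Theorems/SmoothNoHair/Negative/SmoothNoHairFalseWithoutConnected.lean`
(refuter crux-attack at birth, p143023): `smoothNoHair_false_without_connected` — the crux with
`IsConnected 𝓑.horizon` deleted is FALSE (witness `minkowskiBH`, empty horizon, collar hypothesis vacuous).
HONOURED: every stub keeps `IsConnected 𝓑.horizon` among its hypotheses (stubs 1, 2 are the route items, which
carry it; stub 3 carries it verbatim), so no stub is an instance of the refuted connectedness-free variant, and
the case split uses connectedness nowhere else.  `ledger negatives --problem FinalStateConjecture`: no entry on
stationary uniqueness.  Dead lines: none recorded for this crux.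
-/

noncomputable section

-- D-0017: single-problem summit, `Summit.<S>.<S>.…` by design (cf. lakefile `weak.linter.dupNamespace`).
set_option linter.dupNamespace false

namespace Summit.FinalStateConjecture.FinalStateConjecture.Cruxes.SmoothNoHair.Birth

open scoped Manifold ContDiff Topology

/-! ## §1 The three registered stubs (the only `sorry`s of the file) -/

/-- **Stub 1 — leaf 2a, the non-rotating connected type is Schwarzschild ⊂ Kerr** (the route's support item
`NonRotatingConnectedIsKerr`, stmt-FinalStateConjecture-18559, BY NAME): an `I⁺`-regular Ricci-flat stationary
AF black hole with connected horizon carrying a non-degenerate Killing collar ON WHICH `T` IS NULL has d.o.c.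
isometric to a sub-extremal Kerr exterior (in fact Schwarzschild, `a = 0`).  Why plausibly true: Sudarsky–Wald
staticity (collar ⇒ `T` hypersurface-orthogonal on the d.o.c.) and static vacuum uniqueness
(Bunting–Masood-ul-Alam 1987; Chruściel–Galloway 2010 for the `I⁺`-regular smooth statement), then
`IsIsometricToSchwarzschildExterior.isIsometricToKerrExterior`.  Size M (from the named facts
`SudarskyWald1993_staticity`, `ChruscielGalloway2010_docStaticUniqueness`; the smooth collar version of
CC08 §7.2 ¶1 is a wanted cite fact).  Why it might fail: only through a mis-dressing of the collar (per-component
`κ` vs the single-`κ` form of the tree's Sudarsky–Wald fact). [cite: SudarskyWald1993] [cite: ChruscielGalloway2010, Thm. 1.1]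
[cite: ChruscielCosta2008, §7.2] -/
theorem stub_nonRotatingConnectedIsKerr :
    Summit.FinalStateConjecture.FinalStateConjecture.Theses.HorizonTypeCascade.NonRotatingConnectedIsKerr := by
  sorry

/-- **Stub 2 — leaf 2b, Hawking rigidity WITHOUT analyticity from the collar** (the route's support item
`SmoothHawkingRigidity`, stmt-FinalStateConjecture-18788, BY NAME; LOAD-BEARING, the frontier): an `I⁺`-regular
Ricci-flat stationary AF black hole with connected horizon carrying a non-degenerate Killing collar, with `T`
non-null somewhere on `𝓔⁺`, carries a complete axisymmetric Killing field `Y` (`2π`-periodic orbits, non-trivial,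
with an axis) commuting with `T`.  Why plausibly true: with analyticity this is Hawking's theorem (Hawking–Ellis
Prop. 9.3.6, Chruściel–Costa 2008 Thm 1.3's use of it); without it, Alexakis–Ionescu–Klainerman extend the collar
Killing field across the d.o.c. for space-times close to Kerr (arXiv:0902.1173, arXiv:1304.0487), and the collar
is exactly what their Carleman estimates start from.  Why it might fail: Ionescu–Klainerman local hair
(arXiv:1108.3575 Thm 1.3) — a Killing field on a collar of the horizon need NOT extend in general; the global
extension needs the black-hole boundary conditions at infinity in an essential, not yet understood way
(CCH12 §3.4.2).  Size: open problem. [cite: AlexakisIonescuKlainerman2009] [cite: IonescuKlainerman2012, Thm. 1.3]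
[cite: ChruscielCostaHeusler2012, §3.4.2] -/
theorem stub_smoothHawkingRigidity :
    Summit.FinalStateConjecture.FinalStateConjecture.Theses.HorizonTypeCascade.SmoothHawkingRigidity := by
  sorry

/-- **Stub 3 — leaf 2c, axisymmetric uniqueness in collar dress** (Chruściel–Costa–Heusler 2012 Thm 3.2, vacuum,
connected horizon; verbatim the third binder of the route item `NoHairOfCases`, stmt-FinalStateConjecture-18818):
an `I⁺`-regular stationary AF black hole with connected horizon carrying a non-degenerate Killing collar, which is
stationary-AXISYMMETRIC (`∃ Y`, `Spacetime.IsAxisymmetricKilling Y ∧ [T, Y] = 0`, the body of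
`StationaryAFBlackHole.IsStationaryAxisymmetric`) and Ricci-flat, has d.o.c. isometric to a sub-extremal Kerr
exterior (`hres`-free pointwise form).  Why plausibly true: it is a printed theorem (CCH12 Thm 3.2: area function
CC08 Thm 5.6 with `I⁺`-regularity replacing analyticity, Ernst reduction and Weinstein/Robinson harmonic-map
uniqueness CC08 §6, prehorizons Chruściel–Galloway 2010; non-degeneracy makes the Kerr member sub-extremal).
In-tree route to it: the named fact `ChruscielCostaHeusler2012_axisymmetricUniqueness` plus (i) collar +
axisymmetry ⇒ a global non-degenerate horizon Killing field (`IsNonDegenerateHorizon 𝓑.Mext`) and (ii) the proved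
`kerrConclusionPointwise_iff_isIsometricToKerrExterior`.  Why it might fail: only in dress (i) — if the collar's
`κ` and the Killing generator `T + Ω Y` could disagree on a connected non-degenerate horizon.  Size L (M given the
fact). [cite: ChruscielCostaHeusler2012, Thm. 3.2] [cite: ChruscielCosta2008, Thm. 5.6, §§6–7]
[cite: ChruscielGalloway2010, Thm. 1.1] -/
theorem stub_axisymmetricUniqueness :
    ∀ (𝓑 : Literature.Geometry.Lorentzian.StationaryAFBlackHole.{0}) [𝓑.metric.HasLeviCivita] [Literature.Geometry.Lorentzian.Kerr.Facts] (hF : 𝓑.metric.isOpen_chronologicalFuture 𝓑.timeOrientation) (hP : 𝓑.metric.isOpen_chronologicalPast 𝓑.timeOrientation), 𝓑.IsIPlusRegular → IsConnected 𝓑.horizon → (∀ p ∈ 𝓑.horizon, ∃ (U : Set 𝓑.carrier) (K : Π x : 𝓑.carrier, TangentSpace (𝓡 4) x) (κ : ℝ), IsOpen U ∧ connectedComponentIn 𝓑.horizon p ⊆ U ∧ ContMDiffOn (𝓡 4) ((𝓡 4).prod 𝓘(ℝ, Literature.Geometry.Lorentzian.E4)) ((⊤ : ℕ∞) : WithTop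 ℕ∞) (fun x ↦ (Bundle.TotalSpace.mk' Literature.Geometry.Lorentzian.E4 x (K x) : TangentBundle (𝓡 4) 𝓑.carrier)) U ∧ (∀ x ∈ U, ∀ v w : TangentSpace (𝓡 4) x, 𝓑.metric.val x (𝓑.metric.leviCivita K x v) w + 𝓑.metric.val x v (𝓑.metric.leviCivita K x w) = 0) ∧ (∀ x ∈ U, VectorField.mlieBracket (𝓡 4) 𝓑.killing K x = 0) ∧ (∀ q ∈ connectedComponentIn 𝓑.horizon p, K q ≠ 0) ∧ (∀ γ : ℝ → 𝓑.carrier, IsMIntegralCurve γ K → γ 0 ∈ connectedComponentIn 𝓑.horizon p → ∀ t, γ t ∈ 𝓑.horizon) ∧ κ ≠ 0 ∧ ∀ q ∈ connectedComponentIn 𝓑.horizon p, 𝓑.metric.leviCivita K q (K q) = κ • K q) → (∀ [𝓑.metric.HasLeviCivita], ∃ Y : Π x : 𝓑.carrier, TangentSpace (𝓡 4) x, 𝓑.toSpacetime.IsAxisymmetricKilling Y ∧ ∀ x, VectorField.mlieBracket (𝓡 4) 𝓑.killing Y x = 0) → 𝓑.metric.toPseudoRiemannianMetric.IsRicciFlat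 → (∃ (M a : ℝ) (_ : Literature.Geometry.Lorentzian.Kerr.IsSubextremal M a) (Φ : Diffeomorph (𝓡 4) 𝓘(ℝ, Literature.Geometry.Lorentzian.E4) (𝓑.docOpens hF hP) (Literature.Geometry.Lorentzian.Kerr.exterior M a) ((⊤ : ℕ∞) : WithTop ℕ∞)), ∀ (y : 𝓑.docOpens hF hP) (v w : EuclideanSpace ℝ (Fin 4)), (Literature.Geometry.Lorentzian.Kerr.smoothMetric M a (Literature.Geometry.Lorentzian.Kerr.rPlus M a)).val (Φ y) (mfderiv (𝓡 4) 𝓘(ℝ, Literature.Geometry.Lorentzian.E4) Φ y v) (mfderiv (𝓡 4) 𝓘(ℝ, Literature.Geometry.Lorentzian.E4) Φ y w) = 𝓑.metric.val y.1 v w) := by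
  sorry

/-! ## §2 The composition (kernel-checked; no `sorry` of its own): the crux BY NAME -/

/-- **`SmoothNoHair` from the three stubs** — the registered skeleton theorem: concludes the route decl
`Theses.HorizonTypeCascade.SmoothNoHair` BY NAME, takes no hypotheses, and every `sorry` it depends on sits inside
a declared `stub_*`.  Proof = the printed branching on the horizon type of `T`: if `g(T,T) ≠ 0` somewhere on
`𝓔⁺` (rotating type), stub 2 supplies the axisymmetric Killing field and stub 3 concludes; otherwise `T` is null on
all of `𝓔⁺` (non-rotating type) and stub 1 concludes. [folklore] -/
theorem SmoothNoHair_of :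
    Summit.FinalStateConjecture.FinalStateConjecture.Theses.HorizonTypeCascade.SmoothNoHair := by
  intro 𝓑 _ _ hF hP hreg hvac hconn hcoll
  by_cases hrot : ∃ p ∈ 𝓑.horizon, 𝓑.metric.val p (𝓑.killing p) (𝓑.killing p) ≠ 0
  · -- rotating type: Hawking rigidity from the collar (stub 2), then axisymmetric uniqueness (stub 3)
    exact stub_axisymmetricUniqueness 𝓑 hF hP hreg hconn hcoll
      (stub_smoothHawkingRigidity 𝓑 hreg hvac hconn hcoll hrot) hvac
  · -- non-rotating type: `T` null on all of `𝓔⁺` (stub 1)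
    push Not at hrot
    exact stub_nonRotatingConnectedIsKerr 𝓑 hF hP hreg hvac hconn hcoll hrot

/-! ## §3 The curried reading of BC3 = the route's glue item `NoHairOfCases` (no `sorry`) -/

/-- **The curried reading `stub₁-sig → stub₂-sig → stub₃-sig → SmoothNoHair`, kernel-checked and sorry-free.**
Its statement is, by `δ`-unfolding, LITERALLY the route's support item `NoHairOfCases`
(stmt-FinalStateConjecture-18818: `NonRotatingConnectedIsKerr → SmoothHawkingRigidity → (CCH12 Thm 3.2 in collar
dress) → SmoothNoHair`), so this theorem is also a complete proof term for that item (a prover may land it verbatim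
under `Theorems/`; this registrar seat does not propose).  Same branching as `SmoothNoHair_of` with the stubs
replaced by the hypotheses. [folklore] -/
theorem noHairOfCases_proof :
    Summit.FinalStateConjecture.FinalStateConjecture.Theses.HorizonTypeCascade.NoHairOfCases := by
  intro h₁ h₂ h₃ 𝓑 _ _ hF hP hreg hvac hconn hcoll
  by_cases hrot : ∃ p ∈ 𝓑.horizon, 𝓑.metric.val p (𝓑.killing p) (𝓑.killing p) ≠ 0
  · exact h₃ 𝓑 hF hP hreg hconn hcoll (h₂ 𝓑 hreg hvac hconn hcoll hrot) hvac
  · push Not at hrot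
    exact h₁ 𝓑 hF hP hreg hvac hconn hcoll hrot

/-- The three hypothesis types of the curried reading ARE the statements of the three `stub_*` theorems of §1
(checked by ascription; no `sorry` of their own beyond the stubs'). -/
example : Summit.FinalStateConjecture.FinalStateConjecture.Theses.HorizonTypeCascade.NoHairOfCases :=
  fun h₁ h₂ h₃ ↦ noHairOfCases_proof h₁ h₂ h₃

example : Summit.FinalStateConjecture.FinalStateConjecture.Theses.HorizonTypeCascade.SmoothNoHair :=
  noHairOfCases_proof stub_nonRotatingConnectedIsKerr stub_smoothHawkingRigidity stub_axisymmetricUniqueness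

/-- BC3, written out: `stub₁-sig → stub₂-sig → stub₃-sig → SmoothNoHair` with the three signatures verbatim
(token for token the types of `stub_nonRotatingConnectedIsKerr`, `stub_smoothHawkingRigidity`,
`stub_axisymmetricUniqueness`), closed by `noHairOfCases_proof`. -/
example :
    (∀ (𝓑 : Literature.Geometry.Lorentzian.StationaryAFBlackHole.{0}) [𝓑.metric.HasLeviCivita] [Literature.Geometry.Lorentzian.Kerr.Facts] (hF : 𝓑.metric.isOpen_chronologicalFuture 𝓑.timeOrientation) (hP : 𝓑.metric.isOpen_chronologicalPast 𝓑.timeOrientation), 𝓑.IsIPlusRegular → 𝓑.metric.toPseudoRiemannianMetric.IsRicciFlat → IsConnected 𝓑.horizon → (∀ p ∈ 𝓑.horizon, ∃ (U : Set 𝓑.carrier) (K : Π x : 𝓑.carrier, TangentSpace (𝓡 4) x) (κ : ℝ), IsOpen U ∧ connectedComponentIn 𝓑.horizon p ⊆ U ∧ ContMDiffOn (𝓡 4) ((𝓡 4).prod 𝓘(ℝ, Literature.Geometry.Lorentzian.E4)) ((⊤ : ℕ∞) : WithTop ℕ∞) (fun x ↦ (Bundle.TotalSpace.mk' Literature.Geometry.Lorentzian.E4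 x (K x) : TangentBundle (𝓡 4) 𝓑.carrier)) U ∧ (∀ x ∈ U, ∀ v w : TangentSpace (𝓡 4) x, 𝓑.metric.val x (𝓑.metric.leviCivita K x v) w + 𝓑.metric.val x v (𝓑.metric.leviCivita K x w) = 0) ∧ (∀ x ∈ U, VectorField.mlieBracket (𝓡 4) 𝓑.killing K x = 0) ∧ (∀ q ∈ connectedComponentIn 𝓑.horizon p, K q ≠ 0) ∧ (∀ γ : ℝ → 𝓑.carrier, IsMIntegralCurve γ K → γ 0 ∈ connectedComponentIn 𝓑.horizon p → ∀ t, γ t ∈ 𝓑.horizon) ∧ κ ≠ 0 ∧ ∀ q ∈ connectedComponentIn 𝓑.horizon p, 𝓑.metric.leviCivita K q (K q) = κ • K q) → (∀ p ∈ 𝓑.horizon, 𝓑.metric.val p (𝓑.killing p) (𝓑.killing p) = 0) → (∃ (M a : ℝ) (_ : Literature.Geometry.Lorentzian.Kerr.IsSubextremal M a) (Φ : Diffeomorph (𝓡 4) 𝓘(ℝ, Literature.Geometry.Lorentzian.E4) (𝓑.docOpens hF hP) (Literature.Geometry.Lorentzian.Kerr.exterior M a) ((⊤ : ℕ∞) :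 WithTop ℕ∞)), ∀ (y : 𝓑.docOpens hF hP) (v w : EuclideanSpace ℝ (Fin 4)), (Literature.Geometry.Lorentzian.Kerr.smoothMetric M a (Literature.Geometry.Lorentzian.Kerr.rPlus M a)).val (Φ y) (mfderiv (𝓡 4) 𝓘(ℝ, Literature.Geometry.Lorentzian.E4) Φ y v) (mfderiv (𝓡 4) 𝓘(ℝ, Literature.Geometry.Lorentzian.E4) Φ y w) = 𝓑.metric.val y.1 v w)) →
    (∀ (𝓑 : Literature.Geometry.Lorentzian.StationaryAFBlackHole.{0}) [𝓑.metric.HasLeviCivita], 𝓑.IsIPlusRegular → 𝓑.metric.toPseudoRiemannianMetric.IsRicciFlat → IsConnected 𝓑.horizon → (∀ p ∈ 𝓑.horizon, ∃ (U : Set 𝓑.carrier) (K : Π x : 𝓑.carrier, TangentSpace (𝓡 4) x) (κ : ℝ), IsOpen U ∧ connectedComponentIn 𝓑.horizon p ⊆ U ∧ ContMDiffOn (𝓡 4) ((𝓡 4).prod 𝓘(ℝ, Literature.Geometry.Lorentzian.E4)) ((⊤ : ℕ∞) : WithTop ℕ∞) (fun x ↦ (Bundle.TotalSpace.mk' Literature.Geometry.Lorentzian.E4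 x (K x) : TangentBundle (𝓡 4) 𝓑.carrier)) U ∧ (∀ x ∈ U, ∀ v w : TangentSpace (𝓡 4) x, 𝓑.metric.val x (𝓑.metric.leviCivita K x v) w + 𝓑.metric.val x v (𝓑.metric.leviCivita K x w) = 0) ∧ (∀ x ∈ U, VectorField.mlieBracket (𝓡 4) 𝓑.killing K x = 0) ∧ (∀ q ∈ connectedComponentIn 𝓑.horizon p, K q ≠ 0) ∧ (∀ γ : ℝ → 𝓑.carrier, IsMIntegralCurve γ K → γ 0 ∈ connectedComponentIn 𝓑.horizon p → ∀ t, γ t ∈ 𝓑.horizon) ∧ κ ≠ 0 ∧ ∀ q ∈ connectedComponentIn 𝓑.horizon p, 𝓑.metric.leviCivita K q (K q) = κ • K q) → (∃ p ∈ 𝓑.horizon, 𝓑.metric.val p (𝓑.killing p) (𝓑.killing p) ≠ 0) → (∀ [𝓑.metric.HasLeviCivita], ∃ Y : Π x : 𝓑.carrier, TangentSpace (𝓡 4) x, 𝓑.toSpacetime.IsAxisymmetricKilling Y ∧ ∀ x, VectorField.mlieBracket (𝓡 4) 𝓑.killing Y x = 0)) →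
    (∀ (𝓑 : Literature.Geometry.Lorentzian.StationaryAFBlackHole.{0}) [𝓑.metric.HasLeviCivita] [Literature.Geometry.Lorentzian.Kerr.Facts] (hF : 𝓑.metric.isOpen_chronologicalFuture 𝓑.timeOrientation) (hP : 𝓑.metric.isOpen_chronologicalPast 𝓑.timeOrientation), 𝓑.IsIPlusRegular → IsConnected 𝓑.horizon → (∀ p ∈ 𝓑.horizon, ∃ (U : Set 𝓑.carrier) (K : Π x : 𝓑.carrier, TangentSpace (𝓡 4) x) (κ : ℝ), IsOpen U ∧ connectedComponentIn 𝓑.horizon p ⊆ U ∧ ContMDiffOn (𝓡 4) ((𝓡 4).prod 𝓘(ℝ, Literature.Geometry.Lorentzian.E4)) ((⊤ : ℕ∞) : WithTop ℕ∞) (fun x ↦ (Bundle.TotalSpace.mk' Literature.Geometry.Lorentzian.E4 x (K x) : TangentBundle (𝓡 4) 𝓑.carrier)) U ∧ (∀ x ∈ U, ∀ v w : TangentSpace (𝓡 4) x, 𝓑.metric.val x (𝓑.metric.leviCivita K x v) w + 𝓑.metric.val x v (𝓑.metric.leviCivita K x w) = 0) ∧ (∀ x ∈ U, VectorField.mlieBracket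 (𝓡 4) 𝓑.killing K x = 0) ∧ (∀ q ∈ connectedComponentIn 𝓑.horizon p, K q ≠ 0) ∧ (∀ γ : ℝ → 𝓑.carrier, IsMIntegralCurve γ K → γ 0 ∈ connectedComponentIn 𝓑.horizon p → ∀ t, γ t ∈ 𝓑.horizon) ∧ κ ≠ 0 ∧ ∀ q ∈ connectedComponentIn 𝓑.horizon p, 𝓑.metric.leviCivita K q (K q) = κ • K q) → (∀ [𝓑.metric.HasLeviCivita], ∃ Y : Π x : 𝓑.carrier, TangentSpace (𝓡 4) x, 𝓑.toSpacetime.IsAxisymmetricKilling Y ∧ ∀ x, VectorField.mlieBracket (𝓡 4) 𝓑.killing Y x = 0) → 𝓑.metric.toPseudoRiemannianMetric.IsRicciFlat → (∃ (M a : ℝ) (_ : Literature.Geometry.Lorentzian.Kerr.IsSubextremal M a) (Φ : Diffeomorph (𝓡 4) 𝓘(ℝ, Literature.Geometry.Lorentzian.E4) (𝓑.docOpens hF hP) (Literature.Geometry.Lorentzian.Kerr.exterior M a) ((⊤ : ℕ∞) : WithTop ℕ∞)), ∀ (y : 𝓑.docOpens hF hP) (v w : EuclideanSpace ℝ (Fin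 4)), (Literature.Geometry.Lorentzian.Kerr.smoothMetric M a (Literature.Geometry.Lorentzian.Kerr.rPlus M a)).val (Φ y) (mfderiv (𝓡 4) 𝓘(ℝ, Literature.Geometry.Lorentzian.E4) Φ y v) (mfderiv (𝓡 4) 𝓘(ℝ, Literature.Geometry.Lorentzian.E4) Φ y w) = 𝓑.metric.val y.1 v w)) →
    Summit.FinalStateConjecture.FinalStateConjecture.Theses.HorizonTypeCascade.SmoothNoHair :=
  noHairOfCases_proof

end Summit.FinalStateConjecture.FinalStateConjecture.Cruxes.SmoothNoHair.Birth

end
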